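import Mathlib
import Literature.Analysis.FluidPDE.ESSLocalHolderHarmonicLiouville
import Summits.NavierStokesRegularity.NavierStokesRegularity.Theorems.EulerZoomLiouvillePowerGaugeEulerLiouvilleSelfSimilarEndpointRieszGlobal
import HarnessLib

/-!
# Rung C1 of the crux `EulerZoomLiouville.PowerGaugeEulerLiouville`: identification of a pressure
# solving the weak Poisson equation with the scale-wise Riesz pressure (sub-cubic growth)

Route №10 `EulerZoomLiouville` (NavierStokesRegularity), crux E = stmt-NavierStokesRegularity-19832,
rung C1 at the endpoint.  Let `V ∈ L² ∩ L³_loc(ℝ³)` and `P ∈ L¹_loc` solve the weak Poisson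
equation `∫ P Δθ = −∫ D²θ(V, V)` (every exactly self-similar member of E's class does:
`…ProfilePoisson`).  If `∫_{B_L} |P|` and `∫_{B_L} ‖V‖³` grow at most like `L^{3−σ}` (`σ > 0`),
then `P` IS the scale-wise Riesz pressure: `P = Π[V·1_{B_R}] + ∫_{|z| ≥ R} K(·−z)(V z) dz` a.e.
on `B_{R/2}`, for every `R > 0`.  Proof: with the global representative `Q` of the `Q_R`
(`exists_global_scaleQ`), `h = P − Q ∈ L¹_loc` is weakly harmonic on `ℝ³` (both solve the
Poisson equation on every `B_{R/2}`) with `∫_{B(0,k+2)} |h| ≲ (k+2)^{3−2σ/3}` (Stein's `L^{3/2}`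
bound for the near field, the kernel bound for the far field); the tree's Liouville theorem for
weakly harmonic functions with sub-cubic `L¹` growth (`ae_eq_zero_of_weaklyHarmonic_of_growth`,
Seregin 2014 §6.6) gives `h = 0`.

* `setIntegral_abs_rieszPressure_le_of_three` — `∫_B |Π[w]| ≤ C_{3/2} (∫‖w‖³)^{2/3} (vol B)^{1/3}`;
* `pressure_ae_eq_scaleQ_of_poisson` — the identification.

WHAT THIS IS NOT: not NS, not E, not rung C1 — it removes the Riesz-representation hypothesis
of the endpoint stratum for members with sublinear profile growth (sequel).
-/

noncomputable section

-- flat `Theorems/<Route><Decl>…` files of one crux share the namespace of the crux (tree convention)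
set_option linter.dupNamespace false

open MeasureTheory Set Filter Topology Metric Function TopologicalSpace
open scoped ENNReal NNReal InnerProductSpace RealInnerProductSpace Laplacian

namespace Summit.NavierStokesRegularity.NavierStokesRegularity.Theorems.PowerGaugeEulerLiouville

open Literature.Analysis Literature.Analysis.FunctionSpaces Literature.Analysis.FluidPDE

variable {V : EuclideanSpace ℝ (Fin 3) → EuclideanSpace ℝ (Fin 3)} {P : EuclideanSpace ℝ (Fin 3) → ℝ}

section SteinReal

/-- **Stein's `L^{3/2}` bound in real form on a set of finite measure:** for `w ∈ L³` with
a set `B` of finite measure,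
`∫_B |Π[w]| ≤ C_{3/2} (∫ ‖w‖³)^{2/3} (vol B)^{1/3}` for `B` of finite measure (Hölder `(3/2, 3)` on `B` and
`‖Π[w]‖_{3/2} ≤ C_{3/2} ‖w‖₃²`). [cite: Stein1971, Ch. II §4.2 Thm. 3] -/
theorem setIntegral_abs_rieszPressure_le_of_three
    {w : EuclideanSpace ℝ (Fin 3) → EuclideanSpace ℝ (Fin 3)} (hw : MemLp w 3 volume)
    {B : Set (EuclideanSpace ℝ (Fin 3))} (hBfin : volume B ≠ ⊤) :
    ∫ y in B, |rieszPressure w y| ≤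
      steinConstThreeHalves * (∫ y, ‖w y‖ ^ 3) ^ (2 / 3 : ℝ) * (volume.real B) ^ (1 / 3 : ℝ) := by
  set Q := rieszPressure w with hQ
  have hQm : MemLp Q (3 / 2 : ℝ≥0∞) volume := memLp_rieszPressure hw
  haveI : IsFiniteMeasure (volume.restrict B) := isFiniteMeasure_restrict.2 hBfin
  -- Hölder `(3/2, 3)` on `B` with the constant function `1`
  have hpq : Real.HolderConjugate (3 / 2 : ℝ) 3 := by rw [Real.holderConjugate_iff]; norm_num
  have h32 : ENNReal.ofReal (3 / 2 : ℝ) = (3 / 2 : ℝ≥0∞) := by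
    rw [ENNReal.ofReal_div_of_pos (by norm_num)]; simp
  have hf : MemLp (fun y => |Q y|) (ENNReal.ofReal (3 / 2 : ℝ)) (volume.restrict B) := by
    rw [h32]; exact (hQm.restrict B).norm
  have hg : MemLp (fun _ : EuclideanSpace ℝ (Fin 3) => (1 : ℝ)) (ENNReal.ofReal 3) (volume.restrict B) :=
    memLp_const 1
  have hH := integral_mul_le_Lp_mul_Lq_of_nonneg hpq (Eventually.of_forall fun y => abs_nonneg (Q y))
    (Eventually.of_forall fun _ => zero_le_one) hf hg
  simp only [mul_one, Real.one_rpow, integral_const, smul_eq_mul, measureReal_restrict_apply_univ] at hH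
  -- `(∫_B |Q|^{3/2})^{2/3} ≤ (∫ |Q|^{3/2})^{2/3} ≤ C (∫ ‖w‖³)^{2/3}`
  have h32ne0 : (3 / 2 : ℝ≥0∞) ≠ 0 := by simp
  have h32netop : (3 / 2 : ℝ≥0∞) ≠ ⊤ := ENNReal.div_ne_top (by norm_num) (by norm_num)
  have hQi : Integrable (fun y => ‖Q y‖ ^ ((3 / 2 : ℝ≥0∞).toReal)) volume :=
    hQm.integrable_norm_rpow h32ne0 h32netop
  have htR : (3 / 2 : ℝ≥0∞).toReal = 3 / 2 := by norm_num
  rw [htR] at hQi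
  set a : ℝ := ∫ y, |Q y| ^ (3 / 2 : ℝ) with ha
  set b : ℝ := ∫ y, ‖w y‖ ^ 3 with hb
  have ha0 : 0 ≤ a := integral_nonneg fun y => by positivity
  have hb0 : 0 ≤ b := integral_nonneg fun y => by positivity
  have haB : ∫ y in B, |Q y| ^ (3 / 2 : ℝ) ≤ a := by
    refine setIntegral_le_integral ?_ (Eventually.of_forall fun y => by positivity)
    refine hQi.congr (Eventually.of_forall fun y => ?_)
    simp [Real.norm_eq_abs]
  have hCZ : a ^ (2 / 3 : ℝ) ≤ steinConstThreeHalves * b ^ (2 / 3 : ℝ) := by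
    have h := eLpNorm_rieszPressure_le hw
    rw [hQm.eLpNorm_eq_integral_rpow_norm h32ne0 h32netop,
      hw.eLpNorm_eq_integral_rpow_norm (by norm_num) (by norm_num)] at h
    simp only [ENNReal.toReal_ofNat, htR, Real.norm_eq_abs] at h
    have e1 : (∫ y, |Q y| ^ (3 / 2 : ℝ)) ^ (3 / 2 : ℝ)⁻¹ = a ^ (2 / 3 : ℝ) := by
      rw [ha, show ((3 : ℝ) / 2)⁻¹ = 2 / 3 by norm_num]
    have e2 : ((∫ y, ‖w y‖ ^ (3 : ℝ)) ^ (3 : ℝ)⁻¹) = b ^ (1 / 3 : ℝ) := by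
      have e3 : (∫ y, ‖w y‖ ^ (3 : ℝ)) = b := by
        rw [hb]; refine integral_congr_ae (Eventually.of_forall fun y => ?_); norm_num
      rw [e3, one_div]
    rw [e1, e2, ← ENNReal.ofReal_pow (by positivity), ← ENNReal.ofReal_coe_nnreal,
      ← ENNReal.ofReal_mul (by positivity), ENNReal.ofReal_le_ofReal_iff (by positivity)] at h
    refine h.trans (le_of_eq ?_)
    rw [← Real.rpow_natCast (b ^ (1 / 3 : ℝ)) 2, ← Real.rpow_mul hb0]
    norm_num
  calc ∫ y in B, |Q y| ≤ (∫ y in B, |Q y| ^ (3 / 2 : ℝ)) ^ (1 / (3 / 2 : ℝ)) *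
        (volume.real B) ^ (1 / (3 : ℝ)) := hH
    _ ≤ a ^ (2 / 3 : ℝ) * (volume.real B) ^ (1 / 3 : ℝ) := by
        rw [show (1 : ℝ) / (3 / 2) = 2 / 3 by norm_num]
        gcongr
    _ ≤ steinConstThreeHalves * b ^ (2 / 3 : ℝ) * (volume.real B) ^ (1 / 3 : ℝ) := by
        gcongr

end SteinReal

section Identification

/-- **Identification of the pressure profile with the scale-wise Riesz pressure.**  Let
`V ∈ L² ∩ L³_loc(ℝ³)`, `P ∈ L¹_loc`, with the weak Poisson equation `∫ P Δθ = −∫ D²θ(V,V)` for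
all test functions and the sub-cubic growth bounds `∫_{B_L} |P| ≤ A L^{3−σ}`,
`∫_{B_L} ‖V‖³ ≤ A L^{3−σ}` (`L ≥ 1`, `0 < σ ≤ 3`).  Then for every `R > 0`, a.e. on `B_{R/2}`:
`P = Π[V·1_{B_R}] + ∫_{|z| ≥ R} K(·−z)(V z) dz`.  (The difference with the global
representative of the `Q_R` is weakly harmonic with sub-cubic `L¹` growth, hence zero:
Seregin 2014, §6.6, via the tree's `ae_eq_zero_of_weaklyHarmonic_of_growth`.)
[cite: Seregin2014, §6.6 p. 129] -/
theorem pressure_ae_eq_scaleQ_of_poisson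
    (hVm : AEStronglyMeasurable V volume) (hV2 : Integrable (fun z => ‖V z‖ ^ 2) volume)
    (hV3 : LocallyIntegrable (fun y => ‖V y‖ ^ 3) volume)
    (hP1 : LocallyIntegrable P volume)
    (hPoisson : ∀ θ : EuclideanSpace ℝ (Fin 3) → ℝ, ContDiff ℝ (⊤ : ℕ∞) θ → HasCompactSupport θ →
      ∫ y, P y * (Δ θ) y = -∫ y, fderiv ℝ (fderiv ℝ θ) y (V y) (V y))
    {A σ : ℝ} (hσ : 0 < σ) (hσ3 : σ ≤ 3) (hA : 0 ≤ A)
    (hPg : ∀ L : ℝ, 1 ≤ L → ∫ y in ball (0 : EuclideanSpace ℝ (Fin 3)) L, |P y| ≤ A * L ^ (3 - σ))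
    (hVg : ∀ L : ℝ, 1 ≤ L →
      ∫ y in ball (0 : EuclideanSpace ℝ (Fin 3)) L, ‖V y‖ ^ 3 ≤ A * L ^ (3 - σ))
    {R : ℝ} (hR : 0 < R) :
    ∀ᵐ y ∂volume, ‖y‖ < R / 2 →
      P y = rieszPressure ((ball (0 : EuclideanSpace ℝ (Fin 3)) R).indicator V) y +
        ∫ z in {z | R ≤ ‖z‖}, pressureKernel (y - z) (V z) := by
  obtain ⟨Q, hQloc, hQR⟩ := exists_global_scaleQ hVm hV2 hV3
  set QR : ℝ → EuclideanSpace ℝ (Fin 3) → ℝ := fun r y =>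
    rieszPressure ((ball (0 : EuclideanSpace ℝ (Fin 3)) r).indicator V) y +
      ∫ z in {z | r ≤ ‖z‖}, pressureKernel (y - z) (V z) with hQRdef
  set h : EuclideanSpace ℝ (Fin 3) → ℝ := fun y => P y - Q y with hh
  have hhloc : LocallyIntegrable h volume := hP1.sub hQloc
  -- (1) `h` is weakly harmonic
  have hharm : ∀ ψ : EuclideanSpace ℝ (Fin 3) → ℝ, ContDiff ℝ (⊤ : ℕ∞) ψ → HasCompactSupport ψ →
      ∫ y, h y * (Δ ψ) y = 0 := by
    intro ψ hψ hψc
    obtain ⟨r₀, hr₀⟩ := hψc.isCompact.isBounded.subset_closedBall (0 : EuclideanSpace ℝ (Fin 3))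
    set R₁ : ℝ := 2 * (|r₀| + 1) with hR₁
    have hR₁0 : 0 < R₁ := by positivity
    have hsupp : tsupport ψ ⊆ ball (0 : EuclideanSpace ℝ (Fin 3)) (R₁ / 2) :=
      hr₀.trans (closedBall_subset_ball (by rw [hR₁]; linarith [le_abs_self r₀]))
    have hψ2 : ContDiff ℝ 2 ψ := contDiff_infty.1 hψ 2
    have hΔc : Continuous (Δ ψ) := FluidPDE.continuous_laplacian hψ2
    have hΔs : HasCompactSupport (Δ ψ) :=
      hψc.mono' fun x hx => by
        contrapose! hx
        simp [laplacian_eq_zero_of_notMem_tsupport hx]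
    have hPi : Integrable (fun y => P y * (Δ ψ) y) volume := by
      have := hP1.integrable_smul_left_of_hasCompactSupport hΔc hΔs
      simpa [smul_eq_mul, mul_comm] using this
    have hQi : Integrable (fun y => Q y * (Δ ψ) y) volume := by
      have := hQloc.integrable_smul_left_of_hasCompactSupport hΔc hΔs
      simpa [smul_eq_mul, mul_comm] using this
    have hsub : ∫ y, h y * (Δ ψ) y = (∫ y, P y * (Δ ψ) y) - ∫ y, Q y * (Δ ψ) y := by
      rw [← integral_sub hPi hQi]
      exact integral_congr_ae (Eventually.of_forall fun y => by rw [hh]; ring)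
    have hQψ : ∫ y, Q y * (Δ ψ) y = ∫ y, QR R₁ y * (Δ ψ) y := by
      refine integral_congr_ae ?_
      filter_upwards [hQR R₁ hR₁0] with y hy
      by_cases hyb : ‖y‖ < R₁ / 2
      · rw [hy hyb]
      · have hy' : y ∉ tsupport ψ := fun h' => hyb (by simpa using hsupp h')
        rw [laplacian_eq_zero_of_notMem_tsupport hy', mul_zero, mul_zero]
    have h3R : MemLp ((ball (0 : EuclideanSpace ℝ (Fin 3)) R₁).indicator V) 3 volume :=
      memLp_indicator_three_of_subset hVm hV3 measurableSet_ball ball_subset_closedBall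
    rw [hsub, hQψ, hQRdef, integral_scaleQ_mul_laplacian hVm hV2 hR₁0 h3R hψ hψc hsupp,
      hPoisson ψ hψ hψc, sub_self]
  -- (2) growth of `∫_{B(0,k+2)} |h|`
  set v₁ : ℝ := volume.real (ball (0 : EuclideanSpace ℝ (Fin 3)) 1) with hv₁
  have hv₁0 : 0 ≤ v₁ := measureReal_nonneg
  set E₂ : ℝ := ∫ z, ‖V z‖ ^ 2 with hE₂
  have hE₂0 : 0 ≤ E₂ := integral_nonneg fun z => by positivity
  set C₀ : ℝ := A + (steinConstThreeHalves * (A * (2 : ℝ) ^ (3 - σ)) ^ (2 / 3 : ℝ) * v₁ ^ (1 / 3 : ℝ)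
      + v₁ * (8 * E₂) / (2 * Real.pi * 8)) with hC₀
  have hC₀0 : 0 ≤ C₀ := by positivity
  have hgrowthk : ∀ k : ℕ,
      ∫ y in ball (0 : EuclideanSpace ℝ (Fin 3)) ((k : ℝ) + 2), |h y| ≤
        C₀ * ((k : ℝ) + 2) ^ (3 - 2 * σ / 3) := by
    intro k
    set L : ℝ := (k : ℝ) + 2 with hL
    have hL1 : 1 ≤ L := by rw [hL]; linarith [(Nat.cast_nonneg k : (0 : ℝ) ≤ k)]
    have hL0 : 0 < L := by linarith
    set B : Set (EuclideanSpace ℝ (Fin 3)) := ball 0 L with hB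
    have hBm : MeasurableSet B := measurableSet_ball
    have hBfin : volume B ≠ ⊤ := measure_ball_lt_top.ne
    have hvolB : volume.real B = L ^ 3 * v₁ := by
      change (volume (ball (0 : EuclideanSpace ℝ (Fin 3)) L)).toReal =
        L ^ 3 * (volume (ball (0 : EuclideanSpace ℝ (Fin 3)) 1)).toReal
      rw [Measure.addHaar_ball_of_pos volume (0 : EuclideanSpace ℝ (Fin 3)) hL0,
        finrank_euclideanSpace_fin, ENNReal.toReal_mul, ENNReal.toReal_ofReal (by positivity)]
    -- `Q = Q_{2L}` a.e. on `B = B_{(2L)/2}`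
    have h2L : 0 < 2 * L := by positivity
    have hQB : ∀ᵐ y ∂(volume.restrict B), Q y = QR (2 * L) y := by
      rw [ae_restrict_iff' hBm]
      filter_upwards [hQR (2 * L) h2L] with y hy hyB
      rw [hB, mem_ball, dist_zero_right] at hyB
      exact hy (by linarith)
    -- the pieces
    have hPB : IntegrableOn P B volume :=
      (hP1.integrableOn_isCompact (isCompact_closedBall 0 L)).mono_set ball_subset_closedBall
    have h3 : MemLp ((ball (0 : EuclideanSpace ℝ (Fin 3)) (2 * L)).indicator V) 3 volume :=
      memLp_indicator_three_of_subset hVm hV3 measurableSet_ball ball_subset_closedBall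
    have hPiB := setIntegral_abs_rieszPressure_le_of_three h3 hBfin
    have hw3 : ∫ y, ‖(ball (0 : EuclideanSpace ℝ (Fin 3)) (2 * L)).indicator V y‖ ^ 3 ≤
        A * (2 * L) ^ (3 - σ) := by
      rw [integral_norm_indicator_pow measurableSet_ball (by norm_num)]
      exact hVg (2 * L) (by linarith)
    have hFarB : ∫ y in B, |∫ z in {z | 2 * L ≤ ‖z‖}, pressureKernel (y - z) (V z)| ≤
        volume.real B * (8 * E₂ / (2 * Real.pi * (2 * L) ^ 3)) := by
      have hb := norm_setIntegral_le_of_norm_le_const (f := fun y =>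
          |∫ z in {z | 2 * L ≤ ‖z‖}, pressureKernel (y - z) (V z)|) hBfin.lt_top
        (C := 8 * E₂ / (2 * Real.pi * (2 * L) ^ 3)) (fun y hy => by
          rw [Real.norm_eq_abs, abs_abs]
          rw [hB, mem_ball, dist_zero_right] at hy
          exact abs_setIntegral_pressureKernel_far_le hV2 h2L (by linarith))
      refine le_trans ?_ (hb.trans (le_of_eq (by ring)))
      exact le_abs_self _
    -- `∫_B |h| ≤ ∫_B |P| + ∫_B |Π| + ∫_B |Far|`
    have hQRB : IntegrableOn (QR (2 * L)) (ball (0 : EuclideanSpace ℝ (Fin 3)) ((2 * L) / 2)) volume :=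
      integrableOn_scaleQ_ball hVm hV2 hV3 h2L
    rw [show (2 * L) / 2 = L by ring] at hQRB
    have hPii : IntegrableOn (fun y => rieszPressure ((ball (0 : EuclideanSpace ℝ (Fin 3)) (2 * L)).indicator V) y)
        B volume := by
      have h32 : (1 : ℝ≥0∞) ≤ 3 / 2 := by
        rw [ENNReal.le_div_iff_mul_le (Or.inl two_ne_zero) (Or.inl ENNReal.ofNat_ne_top)]; norm_num
      exact (((memLp_rieszPressure h3).locallyIntegrable h32).integrableOn_isCompact
        (isCompact_closedBall 0 L)).mono_set ball_subset_closedBall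
    have hFari : IntegrableOn (fun y => ∫ z in {z | 2 * L ≤ ‖z‖}, pressureKernel (y - z) (V z))
        B volume := by
      have := hQRB.sub hPii
      refine this.congr_fun (fun y _ => ?_) hBm
      simp [hQRdef]
    have hsum2 : Integrable (fun y => |rieszPressure ((ball (0 : EuclideanSpace ℝ (Fin 3)) (2 * L)).indicator V) y| +
        |∫ z in {z | 2 * L ≤ ‖z‖}, pressureKernel (y - z) (V z)|) (volume.restrict B) :=
      hPii.abs.add hFari.abs
    have hsplit : ∫ y in B, |h y| ≤ (∫ y in B, |P y|) +
        ((∫ y in B, |rieszPressure ((ball (0 : EuclideanSpace ℝ (Fin 3)) (2 * L)).indicator V) y|) +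
          ∫ y in B, |∫ z in {z | 2 * L ≤ ‖z‖}, pressureKernel (y - z) (V z)|) := by
      rw [← integral_add hPii.abs hFari.abs, ← integral_add hPB.abs hsum2]
      refine integral_mono_ae (hPB.sub (hQRB.congr_fun_ae (hQB.mono fun y hy => hy.symm))).abs
        (hPB.abs.add hsum2) ?_
      filter_upwards [hQB] with y hy
      rw [hh]
      dsimp only
      rw [hy, hQRdef]
      dsimp only
      have := abs_sub (P y) (rieszPressure ((ball (0 : EuclideanSpace ℝ (Fin 3)) (2 * L)).indicator V) y +
        ∫ z in {z | 2 * L ≤ ‖z‖}, pressureKernel (y - z) (V z))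
      have := abs_add_le (rieszPressure ((ball (0 : EuclideanSpace ℝ (Fin 3)) (2 * L)).indicator V) y)
        (∫ z in {z | 2 * L ≤ ‖z‖}, pressureKernel (y - z) (V z))
      linarith
    -- numerics: each piece is `≤ const · L^{3 − 2σ/3}`
    have hLpow : ∀ {e : ℝ}, e ≤ 3 - 2 * σ / 3 → L ^ e ≤ L ^ (3 - 2 * σ / 3) :=
      fun he => Real.rpow_le_rpow_of_exponent_le hL1 he
    have hP' : ∫ y in B, |P y| ≤ A * L ^ (3 - 2 * σ / 3) :=
      (hPg L hL1).trans (mul_le_mul_of_nonneg_left (hLpow (by linarith)) hA)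
    have hPi' : ∫ y in B, |rieszPressure ((ball (0 : EuclideanSpace ℝ (Fin 3)) (2 * L)).indicator V) y| ≤
        steinConstThreeHalves * (A * (2 : ℝ) ^ (3 - σ)) ^ (2 / 3 : ℝ) * v₁ ^ (1 / 3 : ℝ) *
          L ^ (3 - 2 * σ / 3) := by
      refine hPiB.trans ?_
      have h1 : (∫ y, ‖(ball (0 : EuclideanSpace ℝ (Fin 3)) (2 * L)).indicator V y‖ ^ 3) ^ (2 / 3 : ℝ) ≤
          (A * (2 : ℝ) ^ (3 - σ)) ^ (2 / 3 : ℝ) * L ^ (2 - 2 * σ / 3) := by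
        have h0 : 0 ≤ ∫ y, ‖(ball (0 : EuclideanSpace ℝ (Fin 3)) (2 * L)).indicator V y‖ ^ 3 :=
          integral_nonneg fun y => by positivity
        calc (∫ y, ‖(ball (0 : EuclideanSpace ℝ (Fin 3)) (2 * L)).indicator V y‖ ^ 3) ^ (2 / 3 : ℝ)
            ≤ (A * (2 * L) ^ (3 - σ)) ^ (2 / 3 : ℝ) := Real.rpow_le_rpow h0 hw3 (by norm_num)
          _ = (A * (2 : ℝ) ^ (3 - σ)) ^ (2 / 3 : ℝ) * L ^ (2 - 2 * σ / 3) := by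
              rw [Real.mul_rpow (by norm_num) hL0.le, ← mul_assoc,
                Real.mul_rpow (by positivity) (by positivity), ← Real.rpow_mul hL0.le]
              congr 2; ring
      have h2 : (volume.real B) ^ (1 / 3 : ℝ) = v₁ ^ (1 / 3 : ℝ) * L := by
        rw [hvolB, Real.mul_rpow (by positivity) hv₁0, ← Real.rpow_natCast L 3,
          ← Real.rpow_mul hL0.le]
        norm_num; ring
      rw [h2]
      calc steinConstThreeHalves * (∫ y, ‖(ball (0 : EuclideanSpace ℝ (Fin 3)) (2 * L)).indicator V y‖ ^ 3) ^
            (2 / 3 : ℝ) * (v₁ ^ (1 / 3 : ℝ) * L)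
          ≤ steinConstThreeHalves * ((A * (2 : ℝ) ^ (3 - σ)) ^ (2 / 3 : ℝ) * L ^ (2 - 2 * σ / 3)) *
              (v₁ ^ (1 / 3 : ℝ) * L) := by gcongr
        _ = steinConstThreeHalves * (A * (2 : ℝ) ^ (3 - σ)) ^ (2 / 3 : ℝ) * v₁ ^ (1 / 3 : ℝ) *
              (L ^ (2 - 2 * σ / 3) * L) := by ring
        _ = steinConstThreeHalves * (A * (2 : ℝ) ^ (3 - σ)) ^ (2 / 3 : ℝ) * v₁ ^ (1 / 3 : ℝ) *
              L ^ (3 - 2 * σ / 3) := by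
            rw [← Real.rpow_add_one hL0.ne']; congr 2; ring
    have hFar' : ∫ y in B, |∫ z in {z | 2 * L ≤ ‖z‖}, pressureKernel (y - z) (V z)| ≤
        v₁ * (8 * E₂) / (2 * Real.pi * 8) * L ^ (3 - 2 * σ / 3) := by
      refine hFarB.trans ?_
      rw [hvolB]
      have hL3 : (2 * L) ^ 3 = 8 * L ^ 3 := by ring
      rw [hL3]
      have h1 : L ^ 3 * v₁ * (8 * E₂ / (2 * Real.pi * (8 * L ^ 3))) = v₁ * (8 * E₂) / (2 * Real.pi * 8) := by
        field_simp
      rw [h1]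
      exact le_mul_of_one_le_right (by positivity) (Real.one_le_rpow hL1 (by linarith))
    calc ∫ y in B, |h y| ≤ (∫ y in B, |P y|) +
          ((∫ y in B, |rieszPressure ((ball (0 : EuclideanSpace ℝ (Fin 3)) (2 * L)).indicator V) y|) +
            ∫ y in B, |∫ z in {z | 2 * L ≤ ‖z‖}, pressureKernel (y - z) (V z)|) := hsplit
      _ ≤ A * L ^ (3 - 2 * σ / 3) +
          (steinConstThreeHalves * (A * (2 : ℝ) ^ (3 - σ)) ^ (2 / 3 : ℝ) * v₁ ^ (1 / 3 : ℝ) *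
              L ^ (3 - 2 * σ / 3) +
            v₁ * (8 * E₂) / (2 * Real.pi * 8) * L ^ (3 - 2 * σ / 3)) := by gcongr
      _ = C₀ * L ^ (3 - 2 * σ / 3) := by rw [hC₀]; ring
  -- (3) the tree's Liouville theorem for weakly harmonic functions with sub-cubic growth
  set ρ : ℕ → ℝ := fun k => (k : ℝ) + 1 with hρ
  set G : ℕ → ℝ := fun k => ∫ y in ball (0 : EuclideanSpace ℝ (Fin 3)) ((k : ℝ) + 2), ‖h y‖ with hG
  have hρt : Tendsto ρ atTop atTop := tendsto_natCast_atTop_atTop.atTop_add tendsto_const_nhds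
  have hG0 : ∀ k, 0 ≤ G k := fun k => integral_nonneg fun y => norm_nonneg _
  have hGk : ∀ k, ∫⁻ x in closedBall (0 : EuclideanSpace ℝ (Fin 3)) (ρ k), ‖h x‖ₑ ≤
      ENNReal.ofReal (G k) := by
    intro k
    have hint : IntegrableOn h (ball (0 : EuclideanSpace ℝ (Fin 3)) ((k : ℝ) + 2)) volume :=
      (hhloc.integrableOn_isCompact (isCompact_closedBall 0 ((k : ℝ) + 2))).mono_set
        ball_subset_closedBall
    rw [hG]
    dsimp only
    rw [ofReal_integral_norm_eq_lintegral_enorm hint]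
    exact lintegral_mono_set (closedBall_subset_ball (by rw [hρ]; dsimp only; linarith))
  have hgrowth : Tendsto (fun k => (ρ k)⁻¹ ^ 3 * G k) atTop (𝓝 0) := by
    have hup : ∀ k, (ρ k)⁻¹ ^ 3 * G k ≤ 8 * C₀ * ((k : ℝ) + 2) ^ (-(2 * σ / 3)) := by
      intro k
      have hk0 : 0 < (k : ℝ) + 1 := by positivity
      have hk2 : 0 < (k : ℝ) + 2 := by positivity
      have hGle : G k ≤ C₀ * ((k : ℝ) + 2) ^ (3 - 2 * σ / 3) := by
        have := hgrowthk k
        rw [hG]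
        refine le_trans (le_of_eq (setIntegral_congr_fun measurableSet_ball fun y _ => ?_)) this
        exact Real.norm_eq_abs _
      have hρ3 : (ρ k)⁻¹ ^ 3 ≤ 8 * ((k : ℝ) + 2) ^ (-(3 : ℝ)) := by
        have h1 : (ρ k)⁻¹ ≤ 2 * ((k : ℝ) + 2)⁻¹ := by
          rw [hρ]
          dsimp only
          rw [inv_eq_one_div, ← div_eq_mul_inv, div_le_div_iff₀ hk0 hk2]
          linarith
        have h2 : (ρ k)⁻¹ ^ 3 ≤ (2 * ((k : ℝ) + 2)⁻¹) ^ 3 :=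
          pow_le_pow_left₀ (inv_nonneg.2 hk0.le) h1 3
        refine h2.trans (le_of_eq ?_)
        rw [Real.rpow_neg hk2.le, show (3 : ℝ) = ((3 : ℕ) : ℝ) by norm_num, Real.rpow_natCast,
          mul_pow, inv_pow]
        norm_num
      calc (ρ k)⁻¹ ^ 3 * G k ≤ (8 * ((k : ℝ) + 2) ^ (-(3 : ℝ))) * (C₀ * ((k : ℝ) + 2) ^ (3 - 2 * σ / 3)) :=
            mul_le_mul hρ3 hGle (hG0 k) (by positivity)
        _ = 8 * C₀ * (((k : ℝ) + 2) ^ (-(3 : ℝ)) * ((k : ℝ) + 2) ^ (3 - 2 * σ / 3)) := by ring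
        _ = 8 * C₀ * ((k : ℝ) + 2) ^ (-(2 * σ / 3)) := by
            rw [← Real.rpow_add hk2]; congr 2; ring
    have hlim : Tendsto (fun k : ℕ => 8 * C₀ * ((k : ℝ) + 2) ^ (-(2 * σ / 3))) atTop (𝓝 0) := by
      have h1 : Tendsto (fun k : ℕ => ((k : ℝ) + 2) ^ (-(2 * σ / 3))) atTop (𝓝 0) :=
        (tendsto_rpow_neg_atTop (by positivity : 0 < 2 * σ / 3)).comp
          (tendsto_natCast_atTop_atTop.atTop_add tendsto_const_nhds)
      simpa using h1.const_mul (8 * C₀)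
    exact squeeze_zero (fun k => mul_nonneg (pow_nonneg (inv_nonneg.2 (by positivity)) _) (hG0 k))
      hup hlim
  have hzero := ae_eq_zero_of_weaklyHarmonic_of_growth hhloc hharm hρt hG0 hGk hgrowth
  -- (4) conclude
  filter_upwards [hzero, hQR R hR] with y hy hyQ hyR
  have hPQ : P y = Q y := by
    have : h y = 0 := hy
    rw [hh] at this
    dsimp only at this
    linarith
  rw [hPQ, hyQ hyR]

end Identification

end Summit.NavierStokesRegularity.NavierStokesRegularity.Theorems.PowerGaugeEulerLiouville
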